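import Literature.Geometry.Kaehler.ComplexTorusProductOfCMEllipticCurves
import Literature.RingTheory.DedekindDomain.LatticeSteinitzClass
import HarnessLib

/-!
# The Steinitz class of a complex torus with multiplication by `𝓞_K` is an isomorphism invariant
# (Narbonne 2022, §2.2 and Theorem 1; O'Meara 81:8; Silverman AT II Prop. 1.2 (a)(iii) for `g = 1`)

Layer `Literature/Geometry/Kaehler`, namespace `Literature.Geometry.Kaehler.ComplexTorus`; lane
`lit-hodgefound` (Track 2 foundations library), family `hodge`. Sequel (FILE 4) of
`ComplexTorusProductOfCMEllipticCurves` (FILE 2: a torus `X = E/Λ` whose lattice is an `𝓞_K`-module,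
`K` imaginary quadratic embedded by `φ`, is `X ≅ ℂⁿ/(φ(𝔞₁) × ⋯ × φ(𝔞ₙ)) ≅ E_{τ₁} × ⋯ × E_{τₙ}`) and of
`RingTheory/DedekindDomain/LatticeSteinitzClass` (FILE 3: O'Meara 81:8, the ideal class
`[𝔞₁⋯𝔞ₙ]` of a pseudo-basis depends only on the lattice).

Sources, VERBATIM.

* F. Narbonne, *Polarized products of elliptic curves with complex multiplication and field of
  moduli `ℚ`* [Narbonne2022PolarizedProductsCM] (held text `paper:arxiv-2203.11982`, p0006), §2.2:
  "Let `L` be a `R`-lattice, i.e., a finitely presented, torsion free `R`-module. Since `R` is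
  maximal, `L` is a module over a Dedekind domain and by [OMe], we can always write `L` as a sum
  `L = ⊕ᵢ₌₁^g 𝔞ᵢxᵢ` with a basis `x₁, …, x_g` of the `K`-vector space `L ⊗_R K` and fractional ideals
  `𝔞₁, …, 𝔞_g` of `R`. The couple `(𝔞ᵢ, xᵢ)` is called a pseudo-basis of `L` and the Steinitz
  class `st(L)` of `L` is defined by the class of the product `𝔞₁⋯𝔞_g` in `Cl(R)`."  and
  **Theorem 1.** "Let `R` be an order in a quadratic imaginary field `K`. There is an equivalence
  of categories between `AV_R`, abelian varieties isomorphic to a product of elliptic curves with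
  CM by `R`, and `R-Lat`, `R`-lattices given by `R : A s.t. A(ℂ) ≃ V/Γ ↦ Γ`, `(ℂ ⊗ L)/L ↤ L` on
  objects and for `f : A(ℂ) ≃ V/Γ → A'(ℂ) ≃ V'/Γ'`, `R(f) = f_rat`."  (proof: "There is an
  isomorphism `φ : V/Γ → ℂ^g/⊕Λᵢ`. […] The lattice `Γ` is stable by multiplication by `R`, indeed,
  `φ_an(RΓ) = Rφ_an(Γ) = R⊕ᵢΛᵢ = ⊕ᵢΛᵢ = φ_an(Γ)` so, `RΓ = Γ`. Moreover, the isomorphism `φ`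
  endows `Γ` with a structure of `R`-module in a natural way […] this structure does not depend on
  the isomorphism `φ` we chose.")
* O. T. O'Meara, *Introduction to Quadratic Forms* [Omeara1963], §81C Prop. 81:8, pp. 213–214
  (two pseudo-bases of one lattice: `𝔞₁…𝔞ₙ = 𝔟₁…𝔟ₙ · det(aᵢⱼ)`) — the tree's
  `Lattice.classGroupMk_prod_eq_of_pseudoBasis`.
* J. H. Silverman, *Advanced Topics in the Arithmetic of Elliptic Curves* [Silverman1994], Ch. II
  §1.1 Prop. 1.2 (a)(iii), pp. 100–101: "`E_𝔞 ≅ E_𝔟` if and only if `ā = b̄` in `𝒞ℒ(R_K)`" — the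
  case `g = 1`, the tree's `isIsomorphic_iff_classGroupMk_eq`.

## What is formalised (theorems only; NO definition, NO named fact)

Vocabulary of the tree: a complex torus `X = E/Λ` is presented by `Ψ : (ι → ℝ) ≃L[ℝ] E`,
`Λ = {latticeVec Ψ m}`; `K` a number field with an embedding `φ : K →+* ℂ`; an
"ideal-product presentation" of `X` is a `ℂ`-linear `C : E ≃ ℂⁿ` with
`C(Λ) = φ(𝔞₁) × ⋯ × φ(𝔞ₙ)` for invertible fractional ideals `𝔞ᵢ` of `𝓞_K` — exactly the output of
FILE 2's `exists_equiv_image_lattice_eq_pi_fin` (which exists iff `Λ` is `φ(𝓞_K)`-stable, `K`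
imaginary quadratic); its Steinitz class is `ClassGroup.mk K (∏ 𝔞ᵢ)`.

* §1 `IsIsomorphic.exists_equiv_image_latticeVec`: an isomorphism `X ≅ X'` has a `ℂ`-linear analytic
  representation `T` with `T(Λ) = Λ'` (Lange Prop. 1.1.6 / (1.2); converse of FILE 2's
  `isIsomorphic_of_image_latticeVec`); **`smul_latticeVec_mem_of_isIsomorphic`** ("`RΓ = Γ`" is
  transported: if `zΛ ⊆ Λ` and `X ≅ X'` then `zΛ' ⊆ Λ'`).
* §2 **`classGroupMk_prod_eq_of_isIsomorphic`** (Theorem 1 on objects + 81:8): two ideal-product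
  presentations `C(Λ) = ∏ φ(𝔞ᵢ)` (`i < n`) of `X` and `C'(Λ') = ∏ φ(𝔟ⱼ)` (`j < n'`) of ISOMORPHIC tori
  have `n = n'` and `[𝔞₁⋯𝔞ₙ] = [𝔟₁⋯𝔟ₙ]` in `Cl(𝓞_K)`: THE STEINITZ CLASS IS AN ISOMORPHISM INVARIANT
  (in particular well defined, `classGroupMk_prod_eq_of_image_eq`).
* §3 **`classGroupMk_prod_eq_of_isIsomorphic_pi_ellipticPeriod`**: for products of CM elliptic
  curves `E_{τᵢ} = ℂ/(ℤτᵢ + ℤ)` with `φ(𝔞ᵢ) = cᵢΛ_{τᵢ}` (Silverman's `E_{𝔞ᵢ}`):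
  `E_{𝔞₁} × ⋯ × E_{𝔞_g} ≅ E_{𝔟₁} × ⋯ × E_{𝔟_{g'}} ⟹ g = g' ∧ [𝔞₁⋯𝔞_g] = [𝔟₁⋯𝔟_{g'}]`
  (Prop. 1.2 (a)(iii) "only if" for products).

Not here: the converse ("`st` and the rank determine the `R`-isomorphism class", Steinitz 1911,
whence `E_{𝔞₁} × ⋯ × E_{𝔞_g} ≅ E_R^{g−1} × E_{𝔞₁⋯𝔞_g}`), non-maximal orders `R`.

## References
* [Narbonne2022PolarizedProductsCM] F. Narbonne, *Polarized products of elliptic curves with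
  complex multiplication and field of moduli `ℚ`*, Polynesian J. Math. 1 (5) (2024), arXiv:2203.11982,
  §2.2 and Theorem 1.
* [Omeara1963] O. T. O'Meara, *Introduction to Quadratic Forms*, Springer (1963), §81C 81:8.
* [Silverman1994] J. H. Silverman, *Advanced Topics in the Arithmetic of Elliptic Curves*, GTM 151,
  Springer (1994), Ch. II §1.1 Prop. 1.2 (a)(iii).
* [Lange2023AbelianVarietiesComplex] H. Lange, *Abelian Varieties over the Complex Numbers*,
  Springer (2023), §1.1.2 Prop. 1.1.6 and (1.2).
-/

noncomputable section

open Module Complex NumberField FractionalIdeal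
open scoped nonZeroDivisors Pointwise

namespace Literature.Geometry.Kaehler

namespace ComplexTorus

open Literature.RingTheory.DedekindDomain

/-! ## §1. An isomorphism carries the lattice onto the lattice; transport of `RΓ = Γ` -/

section Transport

variable {ι ι' : Type*} [Fintype ι] [Fintype ι'] [DecidableEq ι] [DecidableEq ι'] {E E' : Type*}
  [NormedAddCommGroup E] [NormedSpace ℂ E] [NormedAddCommGroup E'] [NormedSpace ℂ E']

/-- An integer matrix acts on integer vectors inside `ℝ^ι`: `A_ℝ(m) = (Am)`. [folklore] -/
private theorem map_intCast_mulVec_intCast' {κ κ' : Type*} [Fintype κ] (A : Matrix κ' κ ℤ)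
    (m : κ → ℤ) :
    (A.map (Int.cast : ℤ → ℝ)).mulVec (fun i ↦ (m i : ℝ)) = fun j ↦ ((A.mulVec m) j : ℝ) := by
  funext j
  simp [Matrix.mulVec, dotProduct, Matrix.map_apply]

/-- `(A B)_ℝ = A_ℝ B_ℝ` for integer matrices. [folklore] -/
private theorem map_intCast_mul_aux' {κ κ' κ'' : Type*} [Fintype κ'] (A : Matrix κ κ' ℤ)
    (B : Matrix κ' κ'' ℤ) :
    (A * B).map (Int.cast : ℤ → ℝ) = A.map (Int.cast : ℤ → ℝ) * B.map (Int.cast : ℤ → ℝ) :=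
  Matrix.map_mul (f := Int.castRingHom ℝ)

/-- **The analytic representation of an isomorphism is a `ℂ`-linear `T : E ≃ E'` with `T(Λ) = Λ'`**
(`Φ' ∘ R_ℝ = T ∘ Φ` with `R ∈ GL(ℤ)`: `T(Ψ m) = Ψ'(Rm)` and `T⁻¹(Ψ' m) = Ψ(R⁻¹m)`).
[cite: Lange2023AbelianVarietiesComplex, §1.1.2 Prop. 1.1.6 and (1.2), pp. 19–20] -/
theorem IsIsomorphic.exists_equiv_image_latticeVec {Ψ : (ι → ℝ) ≃L[ℝ] E} {Ψ' : (ι' → ℝ) ≃L[ℝ] E'}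
    (hiso : IsIsomorphic Ψ Ψ') :
    ∃ T : E ≃L[ℂ] E', (∀ n : ι → ℤ, ∃ m : ι' → ℤ, T (latticeVec Ψ n) = latticeVec Ψ' m) ∧
      ∀ m : ι' → ℤ, ∃ n : ι → ℤ, T.symm (latticeVec Ψ' m) = latticeVec Ψ n := by
  obtain ⟨A, B, C, -, hAB, hC⟩ := hiso.exists_matrix
  refine ⟨C, fun n ↦ ⟨A.mulVec n, ?_⟩, fun m ↦ ⟨B.mulVec m, ?_⟩⟩
  · rw [latticeVec, ← hC, map_intCast_mulVec_intCast']
    rfl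
  · rw [ContinuousLinearEquiv.symm_apply_eq]
    change Ψ' (fun j ↦ ((m j : ℤ) : ℝ)) = C (Ψ (fun j ↦ ((B.mulVec m j : ℤ) : ℝ)))
    rw [← map_intCast_mulVec_intCast', ← hC, Matrix.mulVec_mulVec, ← map_intCast_mul_aux', hAB,
      Matrix.map_one Int.cast Int.cast_zero Int.cast_one, Matrix.one_mulVec]

/-- **"`RΓ = Γ`" is transported along isomorphisms** (Narbonne, proof of Thm. 1:
`φ_an(RΓ) = Rφ_an(Γ) = ⋯ = φ_an(Γ)`): if `zΛ ⊆ Λ` for a complex scalar `z` and `X ≅ X'`, then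
`zΛ' ⊆ Λ'`. [cite: Narbonne2022PolarizedProductsCM, §2.2 Theorem 1 (proof)] -/
theorem smul_latticeVec_mem_of_isIsomorphic {Ψ : (ι → ℝ) ≃L[ℝ] E} {Ψ' : (ι' → ℝ) ≃L[ℝ] E'}
    (hiso : IsIsomorphic Ψ Ψ') {z : ℂ}
    (hz : ∀ n : ι → ℤ, ∃ n' : ι → ℤ, z • latticeVec Ψ n = latticeVec Ψ n') (m : ι' → ℤ) :
    ∃ m' : ι' → ℤ, z • latticeVec Ψ' m = latticeVec Ψ' m' := by
  obtain ⟨T, hT, hT'⟩ := hiso.exists_equiv_image_latticeVec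
  obtain ⟨n, hn⟩ := hT' m
  obtain ⟨n', hn'⟩ := hz n
  obtain ⟨m', hm'⟩ := hT n'
  refine ⟨m', ?_⟩
  rw [← hm', ← hn', ContinuousLinearEquiv.map_smul, ← hn, ContinuousLinearEquiv.apply_symm_apply]

end Transport

/-! ## §2. The Steinitz class `[𝔞₁⋯𝔞ₙ]` of `X ≅ ℂⁿ/(φ(𝔞₁) × ⋯ × φ(𝔞ₙ))` is an isomorphism invariant -/

section Steinitz

variable {K : Type} [Field K] [NumberField K] (φ : K →+* ℂ)
variable {ι ι' : Type*} [Fintype ι] [Fintype ι'] [DecidableEq ι] [DecidableEq ι'] {E E' : Type*}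
  [NormedAddCommGroup E] [NormedSpace ℂ E] [NormedAddCommGroup E'] [NormedSpace ℂ E']

/-- **The Steinitz class is an isomorphism invariant** (Narbonne Thm. 1 on objects with O'Meara 81:8):
if `X = E/Λ ≅ X' = E'/Λ'` and `C : E ≃ ℂⁿ`, `C' : E' ≃ ℂ^{n'}` are `ℂ`-linear with
`C(Λ) = φ(𝔞₁) × ⋯ × φ(𝔞ₙ)`, `C'(Λ') = φ(𝔟₁) × ⋯ × φ(𝔟_{n'})` (invertible fractional ideals of `𝓞_K`),
then `n = n'` and `[𝔞₁⋯𝔞ₙ] = [𝔟₁⋯𝔟_{n'}]` in `Cl(𝓞_K)`: the analytic representation `T` of the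
isomorphism is `K`-linear for the `K`-structures through `φ`, so `D = C' ∘ T ∘ C⁻¹` carries the
pseudo-basis `(eᵢ, 𝔞ᵢ)` of `∏ φ(𝔞ᵢ)` to a second pseudo-basis `(Deᵢ, 𝔞ᵢ)` of `∏ φ(𝔟ⱼ) = ⊕ 𝔟ⱼeⱼ`.
[cite: Narbonne2022PolarizedProductsCM, §2.2 (Steinitz class) and Theorem 1]
[cite: Omeara1963, §81C Prop. 81:8, pp. 213–214] -/
theorem classGroupMk_prod_eq_of_isIsomorphic {n n' : ℕ} {Ψ : (ι → ℝ) ≃L[ℝ] E}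
    {Ψ' : (ι' → ℝ) ≃L[ℝ] E'} (hiso : IsIsomorphic Ψ Ψ')
    (𝔞 : Fin n → (FractionalIdeal (𝓞 K)⁰ K)ˣ) (C : E ≃L[ℂ] (Fin n → ℂ))
    (hC : ∀ v : Fin n → ℂ, (∃ m : ι → ℤ, C (latticeVec Ψ m) = v) ↔
      ∀ i, v i ∈ ⇑φ '' ((𝔞 i : FractionalIdeal (𝓞 K)⁰ K) : Set K))
    (𝔟 : Fin n' → (FractionalIdeal (𝓞 K)⁰ K)ˣ) (C' : E' ≃L[ℂ] (Fin n' → ℂ))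
    (hC' : ∀ v : Fin n' → ℂ, (∃ m : ι' → ℤ, C' (latticeVec Ψ' m) = v) ↔
      ∀ j, v j ∈ ⇑φ '' ((𝔟 j : FractionalIdeal (𝓞 K)⁰ K) : Set K)) :
    n = n' ∧ ClassGroup.mk K (∏ i, 𝔞 i) = ClassGroup.mk K (∏ j, 𝔟 j) := by
  classical
  obtain ⟨T, hT, hT'⟩ := hiso.exists_equiv_image_latticeVec
  -- `n = dim E = dim E' = n'`
  have hn : n = n' := by
    have h := (C.symm.toLinearEquiv.trans (T.toLinearEquiv.trans C'.toLinearEquiv)).finrank_eq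
    rwa [Module.finrank_fin_fun, Module.finrank_fin_fun] at h
  subst hn
  refine ⟨rfl, ?_⟩
  -- `V = ℂⁿ` as a `K`-space and `𝓞_K`-module through `φ`
  letI instK : Module K (Fin n → ℂ) := Module.compHom (Fin n → ℂ) φ
  letI instO : Module (𝓞 K) (Fin n → ℂ) := Module.compHom (Fin n → ℂ) (φ.comp (algebraMap (𝓞 K) K))
  have hsmulK : ∀ (c : K) (v : Fin n → ℂ), c • v = (φ c : ℂ) • v := fun _ _ ↦ rfl
  have hsmulO : ∀ (a : 𝓞 K) (v : Fin n → ℂ), a • v = (φ (a : K) : ℂ) • v := fun _ _ ↦ rfl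
  -- `D = C' ∘ T ∘ C⁻¹ : ℂⁿ ≃ ℂⁿ` carries `∏ φ(𝔞ᵢ)` onto `∏ φ(𝔟ⱼ)`
  let D : (Fin n → ℂ) ≃L[ℂ] (Fin n → ℂ) := C.symm.trans (T.trans C')
  have hD : ∀ w, D w = C' (T (C.symm w)) := fun _ ↦ rfl
  have hDmem : ∀ w : Fin n → ℂ, (∀ j, D w j ∈ ⇑φ '' ((𝔟 j : FractionalIdeal (𝓞 K)⁰ K) : Set K)) ↔
      ∀ i, w i ∈ ⇑φ '' ((𝔞 i : FractionalIdeal (𝓞 K)⁰ K) : Set K) := by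
    intro w
    rw [← hC' (D w), ← hC w, hD]
    constructor
    · rintro ⟨m, hm⟩
      have hm' : latticeVec Ψ' m = T (C.symm w) := C'.injective hm
      obtain ⟨k, hk⟩ := hT' m
      refine ⟨k, ?_⟩
      rw [← hk, hm', ContinuousLinearEquiv.symm_apply_apply, ContinuousLinearEquiv.apply_symm_apply]
    · rintro ⟨m, hm⟩
      obtain ⟨k, hk⟩ := hT m
      refine ⟨k, ?_⟩
      rw [← hk, ← hm, ContinuousLinearEquiv.symm_apply_apply]
  -- the lattice `L = ∏ φ(𝔟ⱼ)` as an `𝓞_K`-submodule of `ℂⁿ`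
  let L : Submodule (𝓞 K) (Fin n → ℂ) :=
    { carrier := {v | ∀ j, v j ∈ ⇑φ '' ((𝔟 j : FractionalIdeal (𝓞 K)⁰ K) : Set K)}
      zero_mem' := fun j ↦ ⟨0, (𝔟 j : FractionalIdeal (𝓞 K)⁰ K).zero_mem, map_zero φ⟩
      add_mem' := by
        rintro v w hv hw j
        obtain ⟨b, hb, hbv⟩ := hv j
        obtain ⟨b', hb', hbw⟩ := hw j
        exact ⟨b + b', (𝔟 j : FractionalIdeal (𝓞 K)⁰ K).val.add_mem hb hb',
          by rw [map_add, hbv, hbw, Pi.add_apply]⟩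
      smul_mem' := by
        rintro a v hv j
        obtain ⟨b, hb, hbv⟩ := hv j
        refine ⟨(a : K) * b, ?_, ?_⟩
        · rw [← smul_eq_mul]
          exact (𝔟 j : FractionalIdeal (𝓞 K)⁰ K).val.smul_mem a hb
        · rw [hsmulO, Pi.smul_apply, smul_eq_mul, map_mul, hbv] }
  have hLmem : ∀ v : Fin n → ℂ, v ∈ L ↔
      ∀ j, v j ∈ ⇑φ '' ((𝔟 j : FractionalIdeal (𝓞 K)⁰ K) : Set K) := fun _ ↦ Iff.rfl
  -- `K`-coordinates: `Σ cⱼ • eⱼ = (φ cⱼ)ⱼ`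
  have hsum : ∀ c : Fin n → K,
      ∑ j, c j • (Pi.single j (1 : ℂ) : Fin n → ℂ) = fun j ↦ φ (c j) := by
    intro c
    funext j'
    rw [Finset.sum_apply]
    simp only [hsmulK, Pi.smul_apply, Pi.single_apply, smul_eq_mul, mul_ite, mul_one, mul_zero,
      Finset.sum_ite_eq, Finset.mem_univ, if_true]
  -- the two pseudo-bases `(eⱼ, 𝔟ⱼ)` and `(Deᵢ, 𝔞ᵢ)` of `L`
  have hliy : LinearIndependent K (fun j ↦ (Pi.single j (1 : ℂ) : Fin n → ℂ)) := by
    refine Fintype.linearIndependent_iff.2 fun c hc j ↦ ?_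
    rw [hsum] at hc
    exact (map_eq_zero φ).1 (congrFun hc j)
  have hlix : LinearIndependent K (fun i ↦ D (Pi.single i (1 : ℂ))) := by
    refine Fintype.linearIndependent_iff.2 fun c hc i ↦ ?_
    have h : D (∑ i, c i • (Pi.single i (1 : ℂ) : Fin n → ℂ)) = 0 := by
      rw [map_sum, ← hc]
      exact Finset.sum_congr rfl fun i _ ↦ by rw [hsmulK, hsmulK, ContinuousLinearEquiv.map_smul]
    rw [D.map_eq_zero_iff, hsum] at h
    exact (map_eq_zero φ).1 (congrFun h i)
  have h𝔟 : ∀ v : Fin n → ℂ, v ∈ L ↔ ∃ c : Fin n → K,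
      (∀ j, c j ∈ (𝔟 j : FractionalIdeal (𝓞 K)⁰ K)) ∧
        v = ∑ j, c j • (Pi.single j (1 : ℂ) : Fin n → ℂ) := by
    intro v
    rw [hLmem]
    constructor
    · intro hv
      choose c hc hcv using hv
      exact ⟨c, hc, by rw [hsum]; exact funext fun j ↦ (hcv j).symm⟩
    · rintro ⟨c, hc, rfl⟩ j
      rw [hsum]
      exact ⟨c j, hc j, rfl⟩
  have h𝔞 : ∀ v : Fin n → ℂ, v ∈ L ↔ ∃ c : Fin n → K,
      (∀ i, c i ∈ (𝔞 i : FractionalIdeal (𝓞 K)⁰ K)) ∧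
        v = ∑ i, c i • D (Pi.single i (1 : ℂ)) := by
    intro v
    have hsumD : ∀ c : Fin n → K,
        ∑ i, c i • D (Pi.single i (1 : ℂ)) = D (fun i ↦ φ (c i)) := by
      intro c
      rw [← hsum, map_sum]
      exact Finset.sum_congr rfl fun i _ ↦ by rw [hsmulK, hsmulK, ContinuousLinearEquiv.map_smul]
    rw [hLmem, show v = D (D.symm v) from (D.apply_symm_apply v).symm, hDmem]
    constructor
    · intro hv
      choose c hc hcv using hv
      refine ⟨c, hc, ?_⟩
      rw [hsumD]
      exact congrArg D (funext fun i ↦ (hcv i).symm)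
    · rintro ⟨c, hc, hv⟩ i
      rw [hsumD] at hv
      rw [show D.symm v = fun i ↦ φ (c i) from D.injective hv]
      exact ⟨c i, hc i, rfl⟩
  exact Lattice.classGroupMk_prod_eq_of_pseudoBasis (K := K) (V := Fin n → ℂ) (L := L) 𝔞 𝔟
    hlix hliy h𝔞 h𝔟

/-- **The Steinitz class of `X` is well defined**: two ideal-product presentations
`C(Λ) = ∏ φ(𝔞ᵢ)`, `C'(Λ) = ∏ φ(𝔟ⱼ)` of the SAME torus have `[𝔞₁⋯𝔞ₙ] = [𝔟₁⋯𝔟ₙ]` ("the Steinitz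
class `st(L)` of `L` is defined by the class of the product `𝔞₁⋯𝔞_g` in `Cl(R)`").
[cite: Narbonne2022PolarizedProductsCM, §2.2] [cite: Omeara1963, §81C Prop. 81:8, pp. 213–214] -/
theorem classGroupMk_prod_eq_of_image_eq {n n' : ℕ} (Ψ : (ι → ℝ) ≃L[ℝ] E)
    (𝔞 : Fin n → (FractionalIdeal (𝓞 K)⁰ K)ˣ) (C : E ≃L[ℂ] (Fin n → ℂ))
    (hC : ∀ v : Fin n → ℂ, (∃ m : ι → ℤ, C (latticeVec Ψ m) = v) ↔
      ∀ i, v i ∈ ⇑φ '' ((𝔞 i : FractionalIdeal (𝓞 K)⁰ K) : Set K))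
    (𝔟 : Fin n' → (FractionalIdeal (𝓞 K)⁰ K)ˣ) (C' : E ≃L[ℂ] (Fin n' → ℂ))
    (hC' : ∀ v : Fin n' → ℂ, (∃ m : ι → ℤ, C' (latticeVec Ψ m) = v) ↔
      ∀ j, v j ∈ ⇑φ '' ((𝔟 j : FractionalIdeal (𝓞 K)⁰ K) : Set K)) :
    n = n' ∧ ClassGroup.mk K (∏ i, 𝔞 i) = ClassGroup.mk K (∏ j, 𝔟 j) :=
  classGroupMk_prod_eq_of_isIsomorphic φ (IsIsomorphic.refl Ψ) 𝔞 C hC 𝔟 C' hC'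

end Steinitz

/-! ## §3. Products of CM elliptic curves: `∏ E_{𝔞ᵢ} ≅ ∏ E_{𝔟ⱼ} ⟹ [∏ 𝔞ᵢ] = [∏ 𝔟ⱼ]` -/

section Elliptic

variable {K : Type} [Field K] [NumberField K] (φ : K →+* ℂ)

/-- The lattice vectors of a product torus `∏ X_k` are the tuples of lattice vectors. [folklore] -/
private theorem latticeVec_piPeriod_apply' {ι : Type*} [Fintype ι] {E : Type*}
    [NormedAddCommGroup E] [NormedSpace ℂ E] {n : ℕ} (F : Fin n → ((ι → ℝ) ≃L[ℝ] E))
    (m : Fin n × ι → ℤ) (k : Fin n) :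
    latticeVec (piPeriod F) m k = latticeVec (F k) fun j ↦ m (k, j) := rfl

/-- **A product of CM elliptic curves `E_{𝔞₁} × ⋯ × E_{𝔞_g}` (`φ(𝔞ᵢ) = cᵢΛ_{τᵢ}`) has the
ideal-product presentation `v ↦ (cᵢvᵢ)ᵢ`: `C(∏ Λ_{τᵢ}) = ∏ φ(𝔞ᵢ)`.**
[cite: Silverman1994, Ch. II §1.1 Prop. 1.2 (a)(i), pp. 99–100] -/
theorem exists_equiv_image_lattice_pi_ellipticPeriod {g : ℕ} {τ : Fin g → ℂ}
    (hτ : ∀ i, (τ i).im ≠ 0) (𝔞 : Fin g → (FractionalIdeal (𝓞 K)⁰ K)ˣ) {c : Fin g → ℂ}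
    (hc : ∀ i, c i ≠ 0)
    (h𝔞 : ∀ i, ⇑φ '' ((𝔞 i : FractionalIdeal (𝓞 K)⁰ K) : Set K) =
      c i • Set.range (latticeVec (ellipticPeriod (hτ i)))) :
    ∃ C : (Fin g → ℂ) ≃L[ℂ] (Fin g → ℂ), ∀ v : Fin g → ℂ,
      (∃ m : Fin g × Fin 2 → ℤ, C (latticeVec (piPeriod fun i ↦ ellipticPeriod (hτ i)) m) = v) ↔
        ∀ i, v i ∈ ⇑φ '' ((𝔞 i : FractionalIdeal (𝓞 K)⁰ K) : Set K) := by
  -- the diagonal rescaling `v ↦ (cᵢ vᵢ)ᵢ`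
  let C₀ : (Fin g → ℂ) ≃ₗ[ℂ] (Fin g → ℂ) :=
    { toFun := fun v i ↦ c i * v i
      invFun := fun v i ↦ (c i)⁻¹ * v i
      map_add' := fun v w ↦ funext fun i ↦ by simp only [Pi.add_apply, mul_add]
      map_smul' := fun a v ↦ funext fun i ↦ by
        simp only [Pi.smul_apply, smul_eq_mul, RingHom.id_apply, mul_left_comm]
      left_inv := fun v ↦ funext fun i ↦ by
        simp only [inv_mul_cancel_left₀ (hc i)]
      right_inv := fun v ↦ funext fun i ↦ by
        simp only [mul_inv_cancel_left₀ (hc i)] }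
  refine ⟨C₀.toContinuousLinearEquiv, fun v ↦ ⟨?_, fun hv ↦ ?_⟩⟩
  · rintro ⟨m, rfl⟩ i
    rw [h𝔞 i]
    exact Set.mem_smul_set.2 ⟨_, ⟨fun j ↦ m (i, j), rfl⟩, (smul_eq_mul _ _).trans rfl⟩
  · have hv' : ∀ i, ∃ k : Fin 2 → ℤ, v i = c i * latticeVec (ellipticPeriod (hτ i)) k := by
      intro i
      have h := hv i
      rw [h𝔞 i] at h
      obtain ⟨_, ⟨k, rfl⟩, hk⟩ := Set.mem_smul_set.1 h
      exact ⟨k, by rw [← hk, smul_eq_mul]⟩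
    choose k hk using hv'
    refine ⟨fun p ↦ k p.1 p.2, funext fun i ↦ ?_⟩
    rw [hk i]
    change c i * latticeVec (piPeriod fun i ↦ ellipticPeriod (hτ i)) (fun p ↦ k p.1 p.2) i = _
    rw [latticeVec_piPeriod_apply']

/-- **`E_{𝔞₁} × ⋯ × E_{𝔞_g} ≅ E_{𝔟₁} × ⋯ × E_{𝔟_{g'}}` implies `g = g'` and `[𝔞₁⋯𝔞_g] = [𝔟₁⋯𝔟_{g'}]`
in `Cl(𝓞_K)`** — Silverman's Prop. 1.2 (a)(iii) "`E_𝔞 ≅ E_𝔟` only if `ā = b̄`" for products of CM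
elliptic curves `E_{𝔞ᵢ} = ℂ/Λ_{τᵢ}`, `φ(𝔞ᵢ) = cᵢΛ_{τᵢ}`: the Steinitz class of the `𝓞_K`-lattice
`⊕ Λ_{τᵢ} ≅ ⊕ 𝔞ᵢ` is an isomorphism invariant.
[cite: Narbonne2022PolarizedProductsCM, §2.2 and Theorem 1]
[cite: Silverman1994, Ch. II §1.1 Prop. 1.2 (a)(iii), pp. 100–101]
[cite: Omeara1963, §81C Prop. 81:8, pp. 213–214] -/
theorem classGroupMk_prod_eq_of_isIsomorphic_pi_ellipticPeriod {g g' : ℕ} {τ : Fin g → ℂ}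
    {τ' : Fin g' → ℂ} (hτ : ∀ i, (τ i).im ≠ 0) (hτ' : ∀ j, (τ' j).im ≠ 0)
    (𝔞 : Fin g → (FractionalIdeal (𝓞 K)⁰ K)ˣ) (𝔟 : Fin g' → (FractionalIdeal (𝓞 K)⁰ K)ˣ)
    {c : Fin g → ℂ} {c' : Fin g' → ℂ} (hc : ∀ i, c i ≠ 0) (hc' : ∀ j, c' j ≠ 0)
    (h𝔞 : ∀ i, ⇑φ '' ((𝔞 i : FractionalIdeal (𝓞 K)⁰ K) : Set K) =
      c i • Set.range (latticeVec (ellipticPeriod (hτ i))))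
    (h𝔟 : ∀ j, ⇑φ '' ((𝔟 j : FractionalIdeal (𝓞 K)⁰ K) : Set K) =
      c' j • Set.range (latticeVec (ellipticPeriod (hτ' j))))
    (hiso : IsIsomorphic (piPeriod fun i ↦ ellipticPeriod (hτ i))
      (piPeriod fun j ↦ ellipticPeriod (hτ' j))) :
    g = g' ∧ ClassGroup.mk K (∏ i, 𝔞 i) = ClassGroup.mk K (∏ j, 𝔟 j) := by
  classical
  obtain ⟨C, hC⟩ := exists_equiv_image_lattice_pi_ellipticPeriod φ hτ 𝔞 hc h𝔞
  obtain ⟨C', hC'⟩ := exists_equiv_image_lattice_pi_ellipticPeriod φ hτ' 𝔟 hc' h𝔟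
  exact classGroupMk_prod_eq_of_isIsomorphic φ hiso 𝔞 C hC 𝔟 C' hC'

end Elliptic

end ComplexTorus

end Literature.Geometry.Kaehler
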